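import Summits.BirchSwinnertonDyer.BirchSwinnertonDyer.Theorems.ThetaPartnerAtTwoSignedKatoUpToAtTwoLayerAwayTrivial
import Summits.BirchSwinnertonDyer.BirchSwinnertonDyer.Theorems.ThetaPartnerAtTwoSignedKatoUpToAtTwoLayerKummerWitness
import Literature.NumberTheory.EllipticCurves.SubgroupSelmerCocycleCriteriaProofs
import Literature.NumberTheory.EllipticCurves.GeomPointsGaloisModule
import Literature.NumberTheory.GaloisRepresentations.ContinuousCorestriction
import HarnessLib

/-!
# Route `ThetaPartnerAtTwo` (TP2), crux K3 `SignedKatoDivisibilityUpToAtTwo` (item stmt-BirchSwinnertonDyer-20308) /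
# K3P′ (item 25631), line `colemanrat` v7 — (PT-orth) bricks, Selmer side at FINITE COEFFICIENT LEVEL:
# a layer Selmer cocycle lifts to `E[p^K]`-coefficients, and its conjugate local restrictions at every `v ∤ p`
# are PRINCIPAL at every sufficiently high level (uniformly over finitely many conjugates)

Lead `bsd-wall-tp2-p2x` g5 (cell `bsd-wall`). HONEST FRAMING: THEOREMS ONLY (no definition, no named fact, no instance, no `sorry`);
closes no item; BSD is NOT proved by any of this.

Why. The Poitou–Tate step of (PT-orth) runs at a FINITE coefficient level `E[2^K]` (Tate reciprocity in the tree is for `μ_n`, `n`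
finite: `sumInvLocalizationEqZero_canonical_of_numberField`), in the SHAPIRO model over `Γ_ℚ` (lead's S2 architecture, bus
2026-08-28T06:4xZ): the global class is `Sh_{Γ_N}^{Γ_ℚ} ψ` for a finite-level cocycle `ψ : Γ_N → E[2^K]` lifting a cocycle `φ_N` of
the layer Selmer class `t_N`, and the local term at a place `v ∤ 2` vanishes because the restriction of `Sh ψ` to the decomposition
group `D_v` vanishes — by the generic `ContinuousShapiroLiftVanishing.map_shapiroLift_eq_zero` this needs, for (finitely many) `σ`,
that the conjugate local restriction `d ↦ ψ(σ⁻¹ d σ)` on `σ D_v σ⁻¹ ∩ Γ_N` be PRINCIPAL with a vector IN `E[2^K]`. The tree knows the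
`E[p^∞]`-version (`…LayerAwayTrivial.resOfLe_conjH1_eq_zero_of_mem_selmerLayer`: Selmer classes of every layer are locally trivial at
`v ∤ p`): `σ φ_N(σ⁻¹ x σ) = x a − a` with a torsion point `a ∈ E[p^∞]` WHOSE ORDER IS NOT CONTROLLED. This file supplies the passage
to finite coefficients: the identity persists verbatim at every level `p^{K'}` killing `a` (and `φ_N`), hence at all large levels,
uniformly over any finite set of `σ` (the coset representatives of `Γ_ℚ/Γ_N` used by the Shapiro lift).

## What is proved (any number field `K`, prime `p`, `ℤ_p`-extension `κ`, `W/K` elliptic)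
* §1 `exists_torsionCocycle_of_pow_nsmul_eq_zero` — a continuous crossed homomorphism `φ : U → E[p^∞](K̄)` on a subgroup `U ≤ Γ_K`
  killed pointwise by `p^K` IS a continuous crossed homomorphism `ψ : U → E[p^K]` in the tree's finite-coefficient model
  `subgroupRep (W.torsionGaloisModule (p^K)).toTopRep U` (the model of `Kato2004.reduceH1Pk` and of the (D-layer) pairing
  `SignedKatoOffTwo.LayerPairing.layerPairingMod`), with the same values in `E(K̄)`.
* §2 `exists_conj_apply_eq_smul_sub_of_mem_selmerLayer` — for `s ∈ Sel_{p^∞}(E/K_N)`, `v ∤ p`, `σ ∈ Γ_K` and ANY cocycle `φ_N` of class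
  `s`: `φ_N(σ⁻¹ d σ) = (σ⁻¹ d σ) • b − b` for some `b ∈ E[p^∞](K̄)` and all `d ∈ D_v` with `σ⁻¹ d σ ∈ Γ_N` (the cocycle form of
  LayerAwayTrivial, in the shape of the hypothesis of `map_shapiroLift_eq_zero`).
* §3 `exists_level_conj_apply_eq_smul_sub` — hence for all `K' ≥ j(σ)` and every finite-level lift `ψ` of `φ_N` at level `p^{K'}`:
  `ψ(σ⁻¹ d σ) = (σ⁻¹ d σ) • b − b` with `b ∈ E[p^{K'}]` — the hypothesis of `map_shapiroLift_eq_zero` at `g = σ`;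
  `exists_level_forall_conj_apply_eq_smul_sub` — UNIFORMLY in `σ` over any finite family.
* §4 (integer index) `exists_torsionCocycle_of_zsmul_eq_zero`, `exists_level_forall_conj_apply_eq_smul_sub_of_dvd` — the same with the
  coefficient module `E[n]` for an ARBITRARY `n : ℤ` (killed values / `p^j ∣ n`), so that both index conventions of the tree
  (`(p : ℤ)^k` of `Kato2004.reduceH1Pk` and `((N : ℕ) : ℤ)` of `SignedKatoOffTwo.LayerPairing.layerPairingMod`) are covered verbatim.

References: [GreenbergLNM1716] §2 Prop. 2.1 (p. 72); [Kobayashi2003] (7.16)–(7.21) (p. 12: the local terms at `v ∤ p` vanish);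
[MilneADT2006] I §6 (local Kummer theory), I Thm. 4.10 (Poitou–Tate); [SerreGaloisCohomology1997] I §2.2, I §5.1.
-/

set_option autoImplicit false
-- the Theorems namespace of this sub repeats the summit name by design (D-0017 nested layout)
set_option linter.dupNamespace false

noncomputable section

open scoped Classical

namespace Summit.BirchSwinnertonDyer.BirchSwinnertonDyer.Theorems

namespace SignedKatoOffTwo.LayerFinite

open NumberField IsDedekindDomain Field WeierstrassCurve
  Literature.NumberTheory.EllipticCurves Literature.NumberTheory.EllipticCurves.GreenbergSelmer
  Literature.NumberTheory.EllipticCurves.CocycleCriteria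
  Literature.NumberTheory.GaloisRepresentations ZpExtension

universe u

/-! ## §1 Lifting an `E[p^∞]`-valued cocycle killed by `p^K` to `E[p^K]`-coefficients -/

section Lift

variable {K : Type u} [Field K] (W : WeierstrassCurve K) (p : ℕ) (U : Subgroup (absoluteGaloisGroup K))

/-- **Finite-level lift of a torsion-valued cocycle.** A continuous crossed homomorphism `φ : U → E[p^∞](K̄)` with `p^{K₀} φ = 0`
pointwise is (the image of) a continuous crossed homomorphism `ψ : U → E[p^{K₀}](K̄)` in the finite-coefficient model
`subgroupRep (W.torsionGaloisModule (p^{K₀})).toTopRep U`, with the same values in `E(K̄)`. (Both coefficient modules are discrete and carry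
the Galois action of `Γ_K` on points; only the ambient subgroup of `E(K̄)` changes.) [cite: SerreGaloisCohomology1997, I §2.2]
[cite: MilneADT2006, I §6] -/
theorem exists_torsionCocycle_of_pow_nsmul_eq_zero (K₀ : ℕ)
    (φ : contOneCocycles (discreteTopRep U (W.geomPrimaryTorsion p)))
    (hφ : ∀ x, (p ^ K₀ : ℕ) • ((φ.1 x : W.geomPrimaryTorsion p) : W.geomPoints) = 0) :
    ∃ ψ : contOneCocycles (subgroupRep (W.torsionGaloisModule ((p : ℤ) ^ K₀)).toTopRep U),
      ∀ x, ((ψ.1 x : geomTorsion W ((p : ℤ) ^ K₀)) : W.geomPoints) = ((φ.1 x : W.geomPrimaryTorsion p) : W.geomPoints) := by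
  -- the values of `φ` lie in `E[p^K₀]`
  have hmem : ∀ x, ((φ.1 x : W.geomPrimaryTorsion p) : W.geomPoints) ∈ geomTorsion W ((p : ℤ) ^ K₀) := fun x ↦
    (Submodule.mem_torsionBy_iff ((p : ℤ) ^ K₀) _).mpr (by rw [← Nat.cast_pow, natCast_zsmul]; exact hφ x)
  -- any retraction `E[p^∞] → E[p^K₀]` agreeing with the identity on `E[p^K₀]`-points (continuity is free: discrete source)
  let g : W.geomPrimaryTorsion p → geomTorsion W ((p : ℤ) ^ K₀) := fun m ↦
    if h : (m : W.geomPoints) ∈ geomTorsion W ((p : ℤ) ^ K₀) then ⟨m, h⟩ else 0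
  have hg : ∀ x, g (φ.1 x) = ⟨((φ.1 x : W.geomPrimaryTorsion p) : W.geomPoints), hmem x⟩ := fun x ↦ by
    simp only [g, dif_pos (hmem x)]
  have hcont : Continuous fun x ↦ g (φ.1 x) :=
    (continuous_of_discreteTopology (f := g)).comp φ.1.continuous
  refine ⟨⟨⟨fun x ↦ g (φ.1 x), hcont⟩, fun a b ↦ ?_⟩, fun x ↦ ?_⟩
  · apply Subtype.ext
    change ((g (φ.1 (a * b)) : geomTorsion W _) : W.geomPoints) =
      ((g (φ.1 a) + (subgroupRep (W.torsionGaloisModule ((p : ℤ) ^ K₀)).toTopRep U).ρ a (g (φ.1 b)) : geomTorsion W _) :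
        W.geomPoints)
    rw [AddMemClass.coe_add, hg, hg, hg]
    have hcoc := congrArg (fun m : W.geomPrimaryTorsion p ↦ (m : W.geomPoints)) (φ.2 a b)
    simp only [AddMemClass.coe_add] at hcoc
    exact hcoc
  · change ((g (φ.1 x) : geomTorsion W _) : W.geomPoints) = _
    rw [hg]

end Lift

/-! ## §2 The cocycle form of «layer Selmer classes are locally trivial at `v ∤ p`» -/

section Local

variable {K : Type u} [Field K] [NumberField K] (W : WeierstrassCurve K) [W.IsElliptic] {p : ℕ} [hp : Fact p.Prime]
  (κ : ZpExtension K p) (v : HeightOneSpectrum (𝓞 K))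

/-- **Conjugate local restrictions of a layer Selmer cocycle are principal (coefficients `E[p^∞]`).** For `s ∈ Sel_{p^∞}(E/K_N)`, a
finite `v ∤ p`, `σ ∈ Γ_K` and ANY continuous crossed homomorphism `φ_N` on `Γ_N` of class `s`, there is `b ∈ E[p^∞](K̄)` with
`φ_N(σ⁻¹ d σ) = (σ⁻¹ d σ) • b − b` for every `d ∈ D_v` with `σ⁻¹ d σ ∈ Γ_N` — the tree's `resOfLe_conjH1_eq_zero_of_mem_selmerLayer`
read on cocycles (`conjH1_oneCocycleClass_mem_ker_resOfLe_iff`, `b = σ⁻¹ a`). [cite: GreenbergLNM1716, §2 Prop. 2.1 (p. 72)]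
[cite: Kobayashi2003, (7.16)–(7.21) (p. 12)] -/
theorem exists_conj_apply_eq_smul_sub_of_mem_selmerLayer (N : ℕ) {s : W.subgroupH1 p (κ.layerSubgroup N)}
    (hs : s ∈ W.selmerLayer κ N) (hpv : ((p : ℕ) : 𝓞 K) ∉ v.asIdeal) (σ : absoluteGaloisGroup K)
    (φN : contOneCocycles (discreteTopRep (κ.layerSubgroup N) (W.geomPrimaryTorsion p)))
    (hφN : oneCocycleClass _ φN = s) :
    ∃ b : W.geomPrimaryTorsion p, ∀ (d : absoluteGaloisGroup K), d ∈ decomp v →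
      ∀ hd : σ⁻¹ * d * σ ∈ κ.layerSubgroup N, φN.1 ⟨σ⁻¹ * d * σ, hd⟩ = (σ⁻¹ * d * σ) • b - b := by
  have h0 := LayerAway.resOfLe_conjH1_eq_zero_of_mem_selmerLayer (κ := κ) (v := v) (W := W) (p := p) N hs hpv σ
  rw [← hφN] at h0
  obtain ⟨a, ha⟩ := (conjH1_oneCocycleClass_mem_ker_resOfLe_iff
    (inf_le_left : κ.layerSubgroup N ⊓ decomp v ≤ κ.layerSubgroup N) σ φN).mp h0
  refine ⟨σ⁻¹ • a, fun d hdD hd ↦ ?_⟩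
  have hdN : d ∈ κ.layerSubgroup N := by
    have h := (κ.layerSubgroup_normal N).conj_mem _ hd σ
    simpa [mul_assoc] using h
  have key := ha ⟨d, Subgroup.mem_inf.mpr ⟨hdN, hdD⟩⟩
  have e : subgroupConj (κ.layerSubgroup N) σ (Subgroup.inclusion inf_le_left ⟨d, Subgroup.mem_inf.mpr ⟨hdN, hdD⟩⟩) =
      ⟨σ⁻¹ * d * σ, hd⟩ := Subtype.ext rfl
  rw [e] at key
  -- `key : σ • φN(σ⁻¹ d σ) = d • a − a`
  have key' := congrArg (fun m : W.geomPrimaryTorsion p ↦ σ⁻¹ • m) key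
  simp only [inv_smul_smul, smul_sub] at key'
  rw [key', smul_smul, smul_smul, mul_assoc, mul_inv_cancel, mul_one]

/-! ## §3 The same at every sufficiently high FINITE coefficient level, uniformly over finitely many conjugates -/

/-- **Finite level, one conjugate.** For `s ∈ Sel_{p^∞}(E/K_N)`, `v ∤ p`, `σ ∈ Γ_K` and a cocycle `φ_N` of class `s`, there is `j` such that
for EVERY level `K' ≥ j` and every continuous crossed homomorphism `ψ : Γ_N → E[p^{K'}]` with the same values as `φ_N`
(`exists_torsionCocycle_of_pow_nsmul_eq_zero`), the conjugate local restriction of `ψ` at `σ` is principal IN `E[p^{K'}]`: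
`ψ(σ⁻¹ d σ) = (σ⁻¹ d σ) • b − b`, `b ∈ E[p^{K'}]`, for all `d ∈ D_v` with `σ⁻¹ d σ ∈ Γ_N` — the hypothesis of
`ContinuousShapiroLiftVanishing.map_shapiroLift_eq_zero` at `g = σ` (the representation `(W.torsionGaloisModule n).toTopRep` acts by
`g • ·`). [cite: GreenbergLNM1716, §2 Prop. 2.1 (p. 72)] [cite: MilneADT2006, I §6] -/
theorem exists_level_conj_apply_eq_smul_sub (N : ℕ) {s : W.subgroupH1 p (κ.layerSubgroup N)}
    (hs : s ∈ W.selmerLayer κ N) (hpv : ((p : ℕ) : 𝓞 K) ∉ v.asIdeal) (σ : absoluteGaloisGroup K)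
    (φN : contOneCocycles (discreteTopRep (κ.layerSubgroup N) (W.geomPrimaryTorsion p)))
    (hφN : oneCocycleClass _ φN = s) :
    ∃ j : ℕ, ∀ K' : ℕ, j ≤ K' →
      ∀ ψ : contOneCocycles (subgroupRep (W.torsionGaloisModule ((p : ℤ) ^ K')).toTopRep (κ.layerSubgroup N)),
        (∀ x, ((ψ.1 x : geomTorsion W ((p : ℤ) ^ K')) : W.geomPoints) = ((φN.1 x : W.geomPrimaryTorsion p) : W.geomPoints)) →
        ∃ b : geomTorsion W ((p : ℤ) ^ K'), ∀ (d : absoluteGaloisGroup K), d ∈ decomp v →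
          ∀ hd : σ⁻¹ * d * σ ∈ κ.layerSubgroup N, ψ.1 ⟨σ⁻¹ * d * σ, hd⟩ = (σ⁻¹ * d * σ) • b - b := by
  obtain ⟨b, hb⟩ := exists_conj_apply_eq_smul_sub_of_mem_selmerLayer W κ v N hs hpv σ φN hφN
  obtain ⟨j, hj⟩ := (AddCommGroup.mem_primaryComponent).1 b.2
  refine ⟨j, fun K' hK' ψ hψ ↦ ?_⟩
  have hbK' : (b : W.geomPoints) ∈ geomTorsion W ((p : ℤ) ^ K') := by
    refine (Submodule.mem_torsionBy_iff ((p : ℤ) ^ K') _).mpr ?_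
    obtain ⟨e, rfl⟩ := Nat.exists_eq_add_of_le hK'
    rw [← Nat.cast_pow, natCast_zsmul, pow_add, mul_nsmul, hj, nsmul_zero]
  refine ⟨⟨(b : W.geomPoints), hbK'⟩, fun d hdD hd ↦ Subtype.ext ?_⟩
  rw [hψ, hb d hdD hd, AddSubgroupClass.coe_sub, primaryComponent.coe_smul, AddSubgroupClass.coe_sub,
    Literature.NumberTheory.EllipticCurves.AddSubgroup.torsionBy.coe_smul]

/-- **Finite level, uniformly over a finite family of conjugates** (e.g. the coset representatives of `Γ_K/Γ_N` entering the Shapiro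
lift): one level `j` works for all `σ_i` simultaneously. [cite: GreenbergLNM1716, §2 Prop. 2.1 (p. 72)] [cite: MilneADT2006, I Thm. 4.10] -/
theorem exists_level_forall_conj_apply_eq_smul_sub {ι : Type*} [Finite ι] (N : ℕ) {s : W.subgroupH1 p (κ.layerSubgroup N)}
    (hs : s ∈ W.selmerLayer κ N) (hpv : ((p : ℕ) : 𝓞 K) ∉ v.asIdeal) (σ : ι → absoluteGaloisGroup K)
    (φN : contOneCocycles (discreteTopRep (κ.layerSubgroup N) (W.geomPrimaryTorsion p)))
    (hφN : oneCocycleClass _ φN = s) :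
    ∃ j : ℕ, ∀ K' : ℕ, j ≤ K' →
      ∀ ψ : contOneCocycles (subgroupRep (W.torsionGaloisModule ((p : ℤ) ^ K')).toTopRep (κ.layerSubgroup N)),
        (∀ x, ((ψ.1 x : geomTorsion W ((p : ℤ) ^ K')) : W.geomPoints) = ((φN.1 x : W.geomPrimaryTorsion p) : W.geomPoints)) →
        ∀ i, ∃ b : geomTorsion W ((p : ℤ) ^ K'), ∀ (d : absoluteGaloisGroup K), d ∈ decomp v →
          ∀ hd : (σ i)⁻¹ * d * σ i ∈ κ.layerSubgroup N, ψ.1 ⟨(σ i)⁻¹ * d * σ i, hd⟩ = ((σ i)⁻¹ * d * σ i) • b - b := by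
  classical
  choose j hj using fun i ↦ exists_level_conj_apply_eq_smul_sub W κ v N hs hpv (σ i) φN hφN
  haveI := Fintype.ofFinite ι
  refine ⟨Finset.univ.sup j, fun K' hK' ψ hψ i ↦ hj i K' ((Finset.le_sup (Finset.mem_univ i)).trans hK') ψ hψ⟩

end Local


/-! ## §4 Integer index: the coefficient module `E[n]`, `n : ℤ` arbitrary -/

section IntIndex

variable {K : Type u} [Field K] (W : WeierstrassCurve K) (p : ℕ) (U : Subgroup (absoluteGaloisGroup K))

/-- **Finite-level lift, integer index.** A continuous crossed homomorphism `φ : U → E[p^∞](K̄)` with `n • φ = 0` pointwise (`n : ℤ`)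
is a continuous crossed homomorphism `ψ : U → E[n](K̄)` in the model `subgroupRep (W.torsionGaloisModule n).toTopRep U`, with the same
values. (For `n = (N : ℕ)` this is the index convention of `SignedKatoOffTwo.LayerPairing.layerPairingMod`.)
[cite: SerreGaloisCohomology1997, I §2.2] [cite: MilneADT2006, I §6] -/
theorem exists_torsionCocycle_of_zsmul_eq_zero (n : ℤ)
    (φ : contOneCocycles (discreteTopRep U (W.geomPrimaryTorsion p)))
    (hφ : ∀ x, n • ((φ.1 x : W.geomPrimaryTorsion p) : W.geomPoints) = 0) :
    ∃ ψ : contOneCocycles (subgroupRep (W.torsionGaloisModule n).toTopRep U),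
      ∀ x, ((ψ.1 x : geomTorsion W n) : W.geomPoints) = ((φ.1 x : W.geomPrimaryTorsion p) : W.geomPoints) := by
  have hmem : ∀ x, ((φ.1 x : W.geomPrimaryTorsion p) : W.geomPoints) ∈ geomTorsion W n := fun x ↦
    (Submodule.mem_torsionBy_iff n _).mpr (hφ x)
  let g : W.geomPrimaryTorsion p → geomTorsion W n := fun m ↦
    if h : (m : W.geomPoints) ∈ geomTorsion W n then ⟨m, h⟩ else 0
  have hg : ∀ x, g (φ.1 x) = ⟨((φ.1 x : W.geomPrimaryTorsion p) : W.geomPoints), hmem x⟩ := fun x ↦ by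
    simp only [g, dif_pos (hmem x)]
  have hcont : Continuous fun x ↦ g (φ.1 x) :=
    (continuous_of_discreteTopology (f := g)).comp φ.1.continuous
  refine ⟨⟨⟨fun x ↦ g (φ.1 x), hcont⟩, fun a b ↦ ?_⟩, fun x ↦ ?_⟩
  · apply Subtype.ext
    change ((g (φ.1 (a * b)) : geomTorsion W _) : W.geomPoints) =
      ((g (φ.1 a) + (subgroupRep (W.torsionGaloisModule n).toTopRep U).ρ a (g (φ.1 b)) : geomTorsion W _) : W.geomPoints)
    rw [AddMemClass.coe_add, hg, hg, hg]
    have hcoc := congrArg (fun m : W.geomPrimaryTorsion p ↦ (m : W.geomPoints)) (φ.2 a b)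
    simp only [AddMemClass.coe_add] at hcoc
    exact hcoc
  · change ((g (φ.1 x) : geomTorsion W _) : W.geomPoints) = _
    rw [hg]

end IntIndex

section IntIndexLocal

variable {K : Type u} [Field K] [NumberField K] (W : WeierstrassCurve K) [W.IsElliptic] {p : ℕ} [hp : Fact p.Prime]
  (κ : ZpExtension K p) (v : HeightOneSpectrum (𝓞 K))

/-- **Finite level, integer index, uniformly over a finite family of conjugates**: for `s ∈ Sel_{p^∞}(E/K_N)`, `v ∤ p`, a finite family
`σ_i` and a cocycle `φ_N` of class `s`, there is `j` such that for EVERY `n : ℤ` with `p^j ∣ n` and every crossed homomorphism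
`ψ : Γ_N → E[n]` with the values of `φ_N`, each conjugate local restriction `d ↦ ψ(σ_i⁻¹ d σ_i)` (`d ∈ D_v`) is principal with a vector
IN `E[n]`. [cite: GreenbergLNM1716, §2 Prop. 2.1 (p. 72)] [cite: MilneADT2006, I Thm. 4.10] -/
theorem exists_level_forall_conj_apply_eq_smul_sub_of_dvd {ι : Type*} [Finite ι] (N : ℕ) {s : W.subgroupH1 p (κ.layerSubgroup N)}
    (hs : s ∈ W.selmerLayer κ N) (hpv : ((p : ℕ) : 𝓞 K) ∉ v.asIdeal) (σ : ι → absoluteGaloisGroup K)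
    (φN : contOneCocycles (discreteTopRep (κ.layerSubgroup N) (W.geomPrimaryTorsion p)))
    (hφN : oneCocycleClass _ φN = s) :
    ∃ j : ℕ, ∀ n : ℤ, ((p ^ j : ℕ) : ℤ) ∣ n →
      ∀ ψ : contOneCocycles (subgroupRep (W.torsionGaloisModule n).toTopRep (κ.layerSubgroup N)),
        (∀ x, ((ψ.1 x : geomTorsion W n) : W.geomPoints) = ((φN.1 x : W.geomPrimaryTorsion p) : W.geomPoints)) →
        ∀ i, ∃ b : geomTorsion W n, ∀ (d : absoluteGaloisGroup K), d ∈ decomp v →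
          ∀ hd : (σ i)⁻¹ * d * σ i ∈ κ.layerSubgroup N, ψ.1 ⟨(σ i)⁻¹ * d * σ i, hd⟩ = ((σ i)⁻¹ * d * σ i) • b - b := by
  classical
  -- per conjugate: a principal vector `b_i ∈ E[p^∞]` of order dividing `p^{j_i}`
  have hone : ∀ i, ∃ j : ℕ, ∃ b : W.geomPrimaryTorsion p, (p ^ j : ℕ) • (b : W.geomPoints) = 0 ∧
      ∀ (d : absoluteGaloisGroup K), d ∈ decomp v → ∀ hd : (σ i)⁻¹ * d * σ i ∈ κ.layerSubgroup N,
        φN.1 ⟨(σ i)⁻¹ * d * σ i, hd⟩ = ((σ i)⁻¹ * d * σ i) • b - b := fun i ↦ by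
    obtain ⟨b, hb⟩ := exists_conj_apply_eq_smul_sub_of_mem_selmerLayer W κ v N hs hpv (σ i) φN hφN
    obtain ⟨j, hj⟩ := (AddCommGroup.mem_primaryComponent).1 b.2
    exact ⟨j, b, hj, hb⟩
  choose j b hjb hb using hone
  haveI := Fintype.ofFinite ι
  refine ⟨Finset.univ.sup j, fun n hn ψ hψ i ↦ ?_⟩
  -- `n • b_i = 0` since `p^{j_i} ∣ p^{sup j} ∣ n`
  have hbi : (b i : W.geomPoints) ∈ geomTorsion W n := by
    refine (Submodule.mem_torsionBy_iff n _).mpr ?_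
    obtain ⟨c, rfl⟩ := hn
    obtain ⟨e, he⟩ := Nat.exists_eq_add_of_le (Finset.le_sup (f := j) (Finset.mem_univ i))
    rw [mul_comm, mul_zsmul, natCast_zsmul, he, pow_add, mul_nsmul, hjb i, nsmul_zero, zsmul_zero]
  refine ⟨⟨(b i : W.geomPoints), hbi⟩, fun d hdD hd ↦ Subtype.ext ?_⟩
  rw [hψ, hb i d hdD hd, AddSubgroupClass.coe_sub, primaryComponent.coe_smul, AddSubgroupClass.coe_sub,
    Literature.NumberTheory.EllipticCurves.AddSubgroup.torsionBy.coe_smul]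

end IntIndexLocal

end SignedKatoOffTwo.LayerFinite

end Summit.BirchSwinnertonDyer.BirchSwinnertonDyer.Theorems

end
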